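import Summits.Ventures.HodgeRepro2.T5InertIwahoriFactorisation

/-!
# The two cells of `K` over the isotropic lines: `N_{0,0} · K_{1,1}` and `w · K_{1,1}`
(cell pub-hodge-repro2, seat p3)

Tier-5 N3 support, towards the count `deg Tₙ = (q³ + 1) q^{4n−3}` of T5-SATAKE-KERNEL-p3.md row 11
(continuation of files 195–198). The congruence subgroup `K_{1,1} = {κ ∈ K : κ₀₁, κ₀₂, κ₁₂ ∈ ϖ R}` is the
stabiliser in `K` of the isotropic line `[e₂]` of the residue form; `K` splits into the BIG CELL
`N_{0,0} · K_{1,1}` (the `κ` with `κ₂₂` a unit) and the SMALL CELL `w · K_{1,1}` (the `κ` with `κ₂₂ ∈ ϖ R`),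
`w = antidiag(1, 1, 1)` the Weyl element:

* `isInteger_inv_or_isInteger_mul_inv` — an integral element is a unit or lies in `ϖ R`; `weylG`, `weylG_mul_self`,
  `coe_weylG_mul` — the Weyl element and the rows of `w κ`;
* **`exists_unipCong_inv_mul_mem_of_isUnit`** — if `κ₂₂` is a unit, `κ ∈ N_{0,0} · K_{1,1}` (the Iwahori
  factorisation of file 198 with `a = b = 0`); **`entry_two_two_isUnit_of_mem_unipCong_mul`** — conversely every
  element of `N_{0,0} · K_{1,1}` has `κ₂₂` a unit;
* **`weylG_mul_mem_congSubgroup_of_not_isUnit`** — if `κ₂₂ ∈ ϖ R`, then `w κ ∈ K_{1,1}` (the unitary relations of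
  the columns `(2, 2)`, `(0, 2)`, `(1, 2)` force `κ₁₂, κ₂₁ ∈ ϖ R` and `κ₀₂` a unit), while `w₂₂ = 0`
  (`weylG_entry_two_two`).

The next file counts: `[K : K_{1,1}] = [N_{0,0} : N_{1,1}] + 1`.

Mathlib + this seat's file 198 and its imports; no display; no device.
§8(d): uses an L-value-free non-vanishing device: NO.
-/

namespace Summit.Ventures.HodgeRepro2.T5InertWeylCells

open Matrix
open Summit.Ventures.HodgeRepro2.T5CartanCellsDistinct Summit.Ventures.HodgeRepro2.T5HermitianThreeElements
  Summit.Ventures.HodgeRepro2.T5UnitaryGroupForm Summit.Ventures.HodgeRepro2.T5UnitaryThreeCorner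
  Summit.Ventures.HodgeRepro2.T5UnitaryHeckeAdjoint Summit.Ventures.HodgeRepro2.T5HeckeBasisCells
  Summit.Ventures.HodgeRepro2.T5InertTopCoefficientMatrix Summit.Ventures.HodgeRepro2.T5InertUnipotentCongruence
  Summit.Ventures.HodgeRepro2.T5InertCongruenceSubgroups Summit.Ventures.HodgeRepro2.T5InertIwahoriFactorisation
  Summit.Ventures.HodgeRepro2.T5CartanDominant

section Lines

variable {R E : Type*} [CommRing R] [IsDomain R] [IsDiscreteValuationRing R] [Field E] [StarRing E]
  [Algebra R E] [IsFractionRing R E]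
  (hstar : ∀ x : E, IsLocalization.IsInteger R x → IsLocalization.IsInteger R (star x))
  (u : E) (hsu : star u = u) (hu0 : u ≠ 0) (hu : IsLocalization.IsInteger R u)
  (hu' : IsLocalization.IsInteger R u⁻¹)
  {ϖ : R} (hϖ : Irreducible ϖ) (hs : star (algebraMap R E ϖ) = algebraMap R E ϖ)

/-! ### The dichotomy for an integral element: a unit or a multiple of `ϖ` -/

omit [StarRing E] in
include hϖ in
/-- An integral element of `E` is a unit of `R` or lies in `ϖ R`. -/
theorem isInteger_inv_or_isInteger_mul_inv {x : E} (hx : IsLocalization.IsInteger R x) :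
    (x ≠ 0 ∧ IsLocalization.IsInteger R x⁻¹) ∨ IsLocalization.IsInteger R (x * (algebraMap R E ϖ)⁻¹) := by
  obtain ⟨x₀, rfl⟩ := hx
  by_cases hunit : IsUnit x₀
  · exact Or.inl ⟨(map_ne_zero_iff _ (IsFractionRing.injective R E)).2 hunit.ne_zero,
      isInteger_inv_of_isUnit hunit⟩
  · right
    have hmem : x₀ ∈ IsLocalRing.maximalIdeal R := (IsLocalRing.mem_maximalIdeal x₀).2 (mem_nonunits_iff.2 hunit)
    rw [hϖ.maximalIdeal_eq, Ideal.mem_span_singleton] at hmem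
    obtain ⟨y, rfl⟩ := hmem
    refine ⟨y, ?_⟩
    have hπ0 : algebraMap R E ϖ ≠ 0 :=
      (map_ne_zero_iff _ (IsFractionRing.injective R E)).2 hϖ.ne_zero
    rw [map_mul, mul_comm, ← mul_assoc, inv_mul_cancel₀ hπ0, one_mul]

omit [IsDomain R] [IsDiscreteValuationRing R] [StarRing E] in
include hϖ in
/-- A non-zero unit of `R` does not lie in `ϖ R`. -/
theorem not_isInteger_mul_inv_of_isInteger_inv {x : E} (hx0 : x ≠ 0)
    (hx : IsLocalization.IsInteger R x⁻¹)
    (hx' : IsLocalization.IsInteger R (x * (algebraMap R E ϖ)⁻¹)) : False := by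
  have : IsLocalization.IsInteger R (algebraMap R E ϖ ^ (-1 : ℤ)) := by
    rw [_root_.zpow_neg_one]
    have := IsLocalization.isInteger_mul hx hx'
    rwa [← mul_assoc, inv_mul_cancel₀ hx0, one_mul] at this
  rw [isInteger_zpow_iff hϖ] at this
  omega

/-! ### The Weyl element -/

/-- The Weyl element `w = antidiag(1, 1, 1)` as an element of `U(antidiag(1, u, 1))`. -/
def weylG : formUnitaryGroup (J3 u) := ⟨permUnit E Fin.revPerm, permUnit_rev3_mem u⟩

omit [IsDomain R] [IsDiscreteValuationRing R] [Algebra R E] [IsFractionRing R E] in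
/-- The Weyl element as a matrix unit. -/
theorem coe_weylG : ((weylG u : formUnitaryGroup (J3 u)) : GL (Fin 3) E) = permUnit E Fin.revPerm := rfl

omit [IsDomain R] [IsDiscreteValuationRing R] [IsFractionRing R E] in
/-- `w ∈ K`. -/
theorem weylG_mem_hyperspecial : weylG u ∈ hyperspecialSubgroup R (J3 u) :=
  permUnit_rev_mem_hyperspecial u

omit [IsDomain R] [IsDiscreteValuationRing R] [Algebra R E] [IsFractionRing R E] in
/-- `w · w = 1`. -/
theorem weylG_mul_self : weylG u * weylG u = 1 := by
  apply Subtype.ext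
  rw [Subgroup.coe_mul, coe_weylG, OneMemClass.coe_one]
  ext1
  rw [Units.val_mul, coe_permUnit_rev3, Units.val_one, Matrix.mul_fin_three, Matrix.one_fin_three,
    fin_three_eq_iff]
  norm_num

omit [IsDomain R] [IsDiscreteValuationRing R] [Algebra R E] [IsFractionRing R E] in
/-- `w⁻¹ = w`. -/
theorem weylG_inv : (weylG u)⁻¹ = weylG u :=
  inv_eq_of_mul_eq_one_right (weylG_mul_self u)

omit [IsDomain R] [IsDiscreteValuationRing R] [Algebra R E] [IsFractionRing R E] in
/-- The entries of `w κ`: the rows of `κ` reversed. -/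
theorem coe_weylG_mul (κ : formUnitaryGroup (J3 u)) :
    (((weylG u * κ : formUnitaryGroup (J3 u)) : GL (Fin 3) E) : Matrix (Fin 3) (Fin 3) E) =
      !![((κ : GL (Fin 3) E) : Matrix (Fin 3) (Fin 3) E) 2 0, ((κ : GL (Fin 3) E) : Matrix (Fin 3) (Fin 3) E) 2 1,
          ((κ : GL (Fin 3) E) : Matrix (Fin 3) (Fin 3) E) 2 2;
        ((κ : GL (Fin 3) E) : Matrix (Fin 3) (Fin 3) E) 1 0, ((κ : GL (Fin 3) E) : Matrix (Fin 3) (Fin 3) E) 1 1,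
          ((κ : GL (Fin 3) E) : Matrix (Fin 3) (Fin 3) E) 1 2;
        ((κ : GL (Fin 3) E) : Matrix (Fin 3) (Fin 3) E) 0 0, ((κ : GL (Fin 3) E) : Matrix (Fin 3) (Fin 3) E) 0 1,
          ((κ : GL (Fin 3) E) : Matrix (Fin 3) (Fin 3) E) 0 2] := by
  rw [Subgroup.coe_mul, coe_weylG]
  exact permUnit_rev3_mul (κ : GL (Fin 3) E) _ _ _ _ _ _ _ _ _ (coe_eq_fin_three (κ : GL (Fin 3) E))

/-! ### The big cell `N_{0,0} · K_{1,1}`: the elements with `κ₂₂` a unit -/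

omit [IsDomain R] [IsDiscreteValuationRing R] in
include hstar hsu hu0 hu hu' hϖ hs in
/-- If `κ ∈ K` has `κ₂₂` a unit of `R`, then `κ ∈ N_{0,0} · K_{1,1}`. -/
theorem exists_unipCong_inv_mul_mem_of_isUnit {κ : formUnitaryGroup (J3 u)}
    (hκK : κ ∈ hyperspecialSubgroup R (J3 u))
    (hrinv : IsLocalization.IsInteger R (((κ : GL (Fin 3) E) : Matrix (Fin 3) (Fin 3) E) 2 2)⁻¹)
    (hr0 : ((κ : GL (Fin 3) E) : Matrix (Fin 3) (Fin 3) E) 2 2 ≠ 0) :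
    ∃ ν ∈ unipCong hstar u hu' hs 0 0 le_rfl,
      ν⁻¹ * κ ∈ congSubgroup hstar u hu0 hu hu' hϖ hs 1 1 le_rfl one_le_two := by
  have hκi := isInteger_apply_of_mem_range ((mem_hyperspecialSubgroup_iff R κ).1 hκK)
  obtain ⟨ν, hν, hK, h01, h02, h12⟩ := exists_unipCong_inv_mul_mem_lower_of_isUnit hstar u hsu hu0 hu hu'
    hϖ hs (a := 0) (b := 0) (hba := le_rfl) hκK (by simpa using hκi 0 2) (by simpa using hκi 1 2) hrinv hr0
  refine ⟨ν, hν, hK, ?_, ?_, ?_⟩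
  · rw [h01, zero_mul]
    exact ⟨0, map_zero _⟩
  · rw [h02, zero_mul]
    exact ⟨0, map_zero _⟩
  · rw [h12, zero_mul]
    exact ⟨0, map_zero _⟩

include hstar hu hϖ in
/-- Every element of `K_{1,1}` has `κ₂₂` a unit. -/
theorem entry_two_two_isUnit_of_mem_congSubgroup_one_one {κ : formUnitaryGroup (J3 u)}
    (hκ : κ ∈ congSubgroup hstar u hu0 hu hu' hϖ hs 1 1 le_rfl one_le_two) :
    IsLocalization.IsInteger R (((κ : GL (Fin 3) E) : Matrix (Fin 3) (Fin 3) E) 2 2)⁻¹ ∧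
      ((κ : GL (Fin 3) E) : Matrix (Fin 3) (Fin 3) E) 2 2 ≠ 0 := by
  obtain ⟨hκK, -, h02, h12⟩ := hκ
  rw [Nat.cast_one, _root_.zpow_neg_one] at h02 h12
  exact isInteger_inv_entry_two_two hstar u hu hϖ hκK h02 h12

omit [IsDomain R] [IsDiscreteValuationRing R] [IsFractionRing R E] in
/-- The entry `(2, 2)` of `ν λ` for `ν ∈ N_{0,0}` is `λ₂₂`. -/
theorem entry_two_two_unipCong_mul {ν ℓ : formUnitaryGroup (J3 u)} (hν : ν ∈ unipCong hstar u hu' hs 0 0 le_rfl) :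
    (((ν * ℓ : formUnitaryGroup (J3 u)) : GL (Fin 3) E) : Matrix (Fin 3) (Fin 3) E) 2 2 =
      ((ℓ : GL (Fin 3) E) : Matrix (Fin 3) (Fin 3) E) 2 2 := by
  obtain ⟨x, z, hν⟩ := hν
  conv_lhs => rw [Subgroup.coe_mul, Units.val_mul, hν, coe_upper3, coe_eq_fin_three (ℓ : GL (Fin 3) E),
    Matrix.mul_fin_three]
  show (0 : E) * _ + 0 * _ + 1 * _ = _
  ring

include hstar hu hϖ in
/-- Every element of `N_{0,0} · K_{1,1}` has `κ₂₂` a unit. -/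
theorem entry_two_two_isUnit_of_mem_unipCong_mul {ν ℓ : formUnitaryGroup (J3 u)}
    (hν : ν ∈ unipCong hstar u hu' hs 0 0 le_rfl)
    (hℓ : ℓ ∈ congSubgroup hstar u hu0 hu hu' hϖ hs 1 1 le_rfl one_le_two) :
    IsLocalization.IsInteger R
        ((((ν * ℓ : formUnitaryGroup (J3 u)) : GL (Fin 3) E) : Matrix (Fin 3) (Fin 3) E) 2 2)⁻¹ ∧
      (((ν * ℓ : formUnitaryGroup (J3 u)) : GL (Fin 3) E) : Matrix (Fin 3) (Fin 3) E) 2 2 ≠ 0 := by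
  rw [entry_two_two_unipCong_mul hstar u hu' hs hν]
  exact entry_two_two_isUnit_of_mem_congSubgroup_one_one hstar u hu0 hu hu' hϖ hs hℓ

/-! ### The small cell `w · K_{1,1}`: the elements with `κ₂₂ ∈ ϖ R` -/

include hstar hu0 hu hu' hϖ hs in
/-- **If `κ ∈ K` has `κ₂₂ ∈ ϖ R`, then `w κ ∈ K_{1,1}`.** The unitary relation of the column pair `(2, 2)`
forces `κ₁₂ ∈ ϖ R`, the relation of `(0, 2)` then makes `κ₀₂` a unit, and the relation of `(1, 2)` forces
`κ₂₁ ∈ ϖ R`; the entries `(0, 1), (0, 2), (1, 2)` of `w κ` are `κ₂₁, κ₂₂, κ₁₂`. -/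
theorem weylG_mul_mem_congSubgroup_of_not_isUnit {κ : formUnitaryGroup (J3 u)}
    (hκK : κ ∈ hyperspecialSubgroup R (J3 u))
    (hr : IsLocalization.IsInteger R
      (((κ : GL (Fin 3) E) : Matrix (Fin 3) (Fin 3) E) 2 2 * (algebraMap R E ϖ)⁻¹)) :
    weylG u * κ ∈ congSubgroup hstar u hu0 hu hu' hϖ hs 1 1 le_rfl one_le_two := by
  have hκi := isInteger_apply_of_mem_range ((mem_hyperspecialSubgroup_iff R κ).1 hκK)
  have hπ0 : algebraMap R E ϖ ≠ 0 :=
    (map_ne_zero_iff _ (IsFractionRing.injective R E)).2 hϖ.ne_zero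
  have hrel := (mem_iff_fin_three u (κ : GL (Fin 3) E) _ _ _ _ _ _ _ _ _
    (coe_eq_fin_three (κ : GL (Fin 3) E))).1 κ.2
  -- an opaque name for the matrix of `κ`
  obtain ⟨M, hM⟩ : ∃ M : Matrix (Fin 3) (Fin 3) E, ((κ : GL (Fin 3) E) : Matrix (Fin 3) (Fin 3) E) = M :=
    ⟨_, rfl⟩
  rw [hM] at hκi hrel hr
  have h22 : star (M 2 2) * M 0 2 + star (M 1 2) * u * M 1 2 + star (M 0 2) * M 2 2 = 0 :=
    hrel.2.2.2.2.2.2.2.2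
  have h02 : star (M 2 0) * M 0 2 + star (M 1 0) * u * M 1 2 + star (M 0 0) * M 2 2 = 1 := hrel.2.2.1
  have h12 : star (M 2 1) * M 0 2 + star (M 1 1) * u * M 1 2 + star (M 0 1) * M 2 2 = 0 :=
    hrel.2.2.2.2.2.1
  -- `M₁₂ ∈ ϖ R`: `u M̄₁₂ M₁₂ = −(M̄₂₂ M₀₂ + M̄₀₂ M₂₂) ∈ ϖ R`, and `ϖ` is prime
  have hsr : IsLocalization.IsInteger R (star (M 2 2) * (algebraMap R E ϖ)⁻¹) := by
    have := hstar _ hr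
    rwa [star_mul, star_inv₀, hs, mul_comm] at this
  have hff : IsLocalization.IsInteger R (star (M 1 2) * M 1 2 * (algebraMap R E ϖ)⁻¹) := by
    have hu'' : star (M 1 2) * M 1 2 * (algebraMap R E ϖ)⁻¹ =
        -((star (M 2 2) * (algebraMap R E ϖ)⁻¹ * M 0 2 + star (M 0 2) * (M 2 2 * (algebraMap R E ϖ)⁻¹)) *
          u⁻¹) := by
      field_simp
      linear_combination h22
    rw [hu'']
    exact isInteger_neg (IsLocalization.isInteger_mul (IsLocalization.isInteger_add
      (IsLocalization.isInteger_mul hsr (hκi 0 2))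
      (IsLocalization.isInteger_mul (hstar _ (hκi 0 2)) hr)) hu')
  have hfϖ : IsLocalization.IsInteger R (M 1 2 * (algebraMap R E ϖ)⁻¹) := by
    obtain ⟨f₀, hf₀⟩ := hκi 1 2
    obtain ⟨fs, hfs⟩ := hstar _ ⟨f₀, hf₀⟩
    obtain ⟨w, hw⟩ := hff
    have hdvd : ϖ ∣ fs * f₀ := by
      refine ⟨w, IsFractionRing.injective R E ?_⟩
      rw [map_mul, map_mul, hfs, hf₀, hw, mul_comm (algebraMap R E ϖ), mul_assoc, inv_mul_cancel₀ hπ0,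
        mul_one]
    have hdvd' : ϖ ∣ f₀ := by
      rcases hϖ.prime.dvd_mul.1 hdvd with ⟨y, hy⟩ | h
      · -- `ϖ ∣ fs`: apply the star, `M₁₂ = star (star M₁₂) = star ϖ · star y`
        obtain ⟨ys, hys⟩ := hstar _ ⟨y, rfl⟩
        refine ⟨ys, IsFractionRing.injective R E ?_⟩
        rw [hf₀, map_mul, hys, ← star_star (M 1 2), ← hfs, hy, map_mul, star_mul, hs, mul_comm]
      · exact h
    obtain ⟨y, hy⟩ := hdvd'
    refine ⟨y, ?_⟩
    rw [← hf₀, hy, map_mul, mul_comm, ← mul_assoc, inv_mul_cancel₀ hπ0, one_mul]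
  -- `M₀₂` is a unit: `star M₂₀ · M₀₂ = 1 − ϖ y`
  have hcunit : IsLocalization.IsInteger R (M 0 2)⁻¹ ∧ M 0 2 ≠ 0 := by
    obtain ⟨a₀, ha₀⟩ := IsLocalization.isInteger_mul (hstar _ (hκi 2 0)) (hκi 0 2)
    obtain ⟨y₀, hy₀⟩ := IsLocalization.isInteger_add
      (IsLocalization.isInteger_mul (IsLocalization.isInteger_mul (hstar _ (hκi 1 0)) hu) hfϖ)
      (IsLocalization.isInteger_mul (hstar _ (hκi 0 0)) hr)
    have hrel' : a₀ + ϖ * y₀ = 1 := by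
      apply IsFractionRing.injective R E
      rw [map_add, map_mul, map_one, ha₀, hy₀, ← h02]
      field_simp
      ring
    have ha₀unit : IsUnit a₀ := isUnit_of_add_irreducible_mul_eq_one hϖ hrel'
    have hA0 : star (M 2 0) * M 0 2 ≠ 0 := by
      rw [← ha₀]
      exact (map_ne_zero_iff _ (IsFractionRing.injective R E)).2 ha₀unit.ne_zero
    have hc0 : M 0 2 ≠ 0 := right_ne_zero_of_mul hA0
    refine ⟨?_, hc0⟩
    have : (M 0 2)⁻¹ = star (M 2 0) * (star (M 2 0) * M 0 2)⁻¹ := by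
      have h20 : star (M 2 0) ≠ 0 := left_ne_zero_of_mul hA0
      field_simp
    rw [this, ← ha₀]
    exact IsLocalization.isInteger_mul (hstar _ (hκi 2 0)) (isInteger_inv_of_isUnit ha₀unit)
  -- `M₂₁ ∈ ϖ R`: `star M₂₁ · M₀₂ = −(M̄₁₁ u M₁₂ + M̄₀₁ M₂₂) ∈ ϖ R`
  have hqϖ : IsLocalization.IsInteger R (M 2 1 * (algebraMap R E ϖ)⁻¹) := by
    have hsq : star (M 2 1) * (algebraMap R E ϖ)⁻¹ =
        -(star (M 1 1) * u * (M 1 2 * (algebraMap R E ϖ)⁻¹) +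
          star (M 0 1) * (M 2 2 * (algebraMap R E ϖ)⁻¹)) * (M 0 2)⁻¹ := by
      have hc0 := hcunit.2
      field_simp
      linear_combination h12
    have hsq' : IsLocalization.IsInteger R (star (M 2 1) * (algebraMap R E ϖ)⁻¹) := by
      rw [hsq]
      exact IsLocalization.isInteger_mul (isInteger_neg (IsLocalization.isInteger_add
        (IsLocalization.isInteger_mul (IsLocalization.isInteger_mul (hstar _ (hκi 1 1)) hu) hfϖ)
        (IsLocalization.isInteger_mul (hstar _ (hκi 0 1)) hr))) hcunit.1
    have := hstar _ hsq'
    rwa [star_mul, star_star, star_inv₀, hs, mul_comm] at this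
  -- assemble: `w κ ∈ K`, and its entries `(0, 1), (0, 2), (1, 2)` are `M₂₁, M₂₂, M₁₂`
  refine ⟨Subgroup.mul_mem _ (weylG_mem_hyperspecial u) hκK, ?_, ?_, ?_⟩ <;>
    rw [coe_weylG_mul, hM, Nat.cast_one, _root_.zpow_neg_one]
  · exact hqϖ
  · exact hr
  · exact hfϖ

omit [IsDomain R] [IsDiscreteValuationRing R] [Algebra R E] [IsFractionRing R E] in
/-- `w₂₂ = 0`. -/
theorem weylG_entry_two_two :
    (((weylG u : formUnitaryGroup (J3 u)) : GL (Fin 3) E) : Matrix (Fin 3) (Fin 3) E) 2 2 = 0 := by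
  rw [coe_weylG, coe_permUnit_rev3]
  rfl

end Lines

end Summit.Ventures.HodgeRepro2.T5InertWeylCells
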